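import Summits.ResolutionOfSingularities.ResolutionOfSingularities.Theorems.FrobeniusClosingPatchingRelPerfectDepthTargetsDefs
import Summits.ResolutionOfSingularities.ResolutionOfSingularities.Theorems.FrobeniusClosingPatchingRelPerfectDepthOne
import Summits.ResolutionOfSingularities.ResolutionOfSingularities.Theorems.FrobeniusClosingPatchingRelPerfectOfAtomBlowup
import HarnessLib

/-!
# Chain W5.2 — the depth ladder `DepthConclusionPerfect ℓ`: BASE RUNG `ℓ = 1` BY NAME, monotonicity,
# exhaustion of the `𝔪`-primary stratum in conclusion form, and the composition of record in LADDER form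

[OURS · L1 W5.2 · F1 ladder glue] Crux `PatchingRelPerfect` (stmt-ResolutionOfSingularities-16161), line
`closed_point_slice`, open stub `stub_atomDimFourBlowup` (CORE). Over plan-1's typed targets F1
(`…DepthTargetsDefs.lean`, p498219) and lead-2's r-d1 assembly (`…DepthOne.lean`, p498024/p498225).

* `hasExceptionalDepth_one_iff` — `HasExceptionalDepth 1 x I` IS `DepthOneTargets.HasExceptionalDepthOne x I`
  (`Iff.rfl`), so the F1 ladder starts at r-d1;
* `HasExceptionalDepth.mono` — the depth classes are nested along `ℓ ≤ ℓ'` (iterate `HasExceptionalDepth.succ`);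
* `hasExceptionalDepth_of_pow_maximalIdeal_le` — `𝔪^N ≤ I` gives depth `N` (with `d = 0`) for any family in `𝔪`;
  `hasExceptionalDepth_of_maximalIdeal_le_radical` — the same from `𝔪 ≤ √I` (`𝔪` finitely generated);
* `DepthConclusionPerfect.anti` — rung `ℓ'` COVERS every lower rung `ℓ ≤ ℓ'`;
* `depthConclusionPerfect_of_depthOneConclusion` / **`depthConclusionPerfect_one`** — THE BASE RUNG: r-d1
  (`DepthOneTargets.depthOne`, modulo CP 2019 Prop. 4.4 + CJS 2020 Thm. 1.4 / 6.9 (a) seq-B as hypotheses) gives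
  `DepthConclusionPerfect ℓ` for every `ℓ ≤ 1`; the perfectness hypothesis is idle at `ℓ = 1`;
* **`core_of_pow_maximalIdeal_le_of_depthLadder`** / `core_of_maximalIdeal_le_radical_of_depthLadder` — the WHOLE
  ladder `∀ ℓ, DepthConclusionPerfect ℓ` yields the core's conclusion (`∃ J T' π, J ≠ ⊥ ∧ Supp J over the closed
  point ∧ IsBlowup π J ∧ T' regular`) for EVERY non-zero `𝔪`-PRIMARY-or-unit ideal of a regular local fourfold
  with perfect residue field (exhaustion `hasExceptionalDepth_of_pow_le` of F1, in conclusion form: `𝔪` is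
  finitely generated, so a spanning family exists and `𝔪^N ≤ I` puts `I` on rung `N`);
* **`patchingRelPerfect_of_printed_of_depthLadder_of_posDimCosupport_of_dimGeFive`** — the composition of record
  (`patchingRelPerfect_of_printed_of_atomDimFourBlowup_of_dimGeFive`, p462937 lineage; lead-1's §5
  `patchingRelPerfect_of_printed_of_depthOne_of_deeper_of_dimGeFive` is its `ℓ = 1` instance) with the WHOLE
  `𝔪`-primary stratum split off: the crux BY NAME from the printed dimension-`≤ 3` inputs, the depth ladder
  `∀ ℓ, DepthConclusionPerfect ℓ`, the open core RESTRICTED TO IDEALS WITH POSITIVE-DIMENSIONAL COSUPPORT (some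
  prime `P ⊋ I`, `P ≠ 𝔪` — i.e. `V(I)` is not the closed point alone) and the parked dimension-`≥ 5` residual.

HONEST SCOPE. CONDITIONAL certificates: the ladder above `ℓ = 1` is OPEN (rung R4 = `ℓ = 2` is being typed;
plan-1 g6 KERNEL NOTE 04:50:53Z / lead-1 LIT NOTE v2: for `ℓ ≥ 3` maximal contact is lost below order `ℓ`), the
positive-dimensional-cosupport stratum and the dimension-`≥ 5` residual are HYPOTHESES, the two dimension-three
theorems enter BY NAME as hypotheses and nowhere as axioms; nothing is restated weaker; the item stays open; no
standing of the core is claimed. NOT statements of the manuscript under review. AI-written; AI review is weaker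
than expert review.

## References (pointers in prose; bib keys of `docs/references.bib`)
* J. Kollár, *Lectures on Resolution of Singularities* (2007), (3.111) Step 3. [Kollar2007]
* V. Cossart, O. Piltant, J. Algebra 529 (2019), Thm. 1.1, Prop. 4.4. [CossartPiltant2019]
* V. Cossart, U. Jannsen, S. Saito, LNM 2270 (2020), Thm. 1.2, Thm. 1.4, Thm. 6.9 (a). [CossartJannsenSaito2020]
* The Stacks Project, Tags 00L6 (powers of the maximal ideal vs. `𝔪`-primary), 080A. [StacksProject]
-/

-- `Summit.<Summit>.<Sub>.Theorems` with `Sub = Summit` (single-conjunct summit, D-0017)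
set_option linter.dupNamespace false

noncomputable section

open CategoryTheory AlgebraicGeometry
open Literature.AlgebraicGeometry.Resolution

namespace Summit.ResolutionOfSingularities.ResolutionOfSingularities.Theorems

universe u

namespace DepthTargets

/-! ## §1 The depth classes: `ℓ = 1` is r-d1's class; nested in `ℓ`; every `𝔪`-primary ideal is on a rung -/

/-- `HasExceptionalDepth 1 x I` is LITERALLY `DepthOneTargets.HasExceptionalDepthOne x I` (both read
`∃ d, I ≤ 𝔪ᵈ ∧ ∀ i, x_i^{d+1} ∈ I`): the F1 ladder starts at the landed rung r-d1. [folklore] -/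
theorem hasExceptionalDepth_one_iff {S : Type u} [CommRing S] [IsLocalRing S] {n : ℕ} (x : Fin n → S)
    (I : Ideal S) : HasExceptionalDepth 1 x I ↔ DepthOneTargets.HasExceptionalDepthOne x I :=
  Iff.rfl

/-- The depth classes are NESTED along `ℓ ≤ ℓ'` (iterate `HasExceptionalDepth.succ`). [folklore] -/
theorem HasExceptionalDepth.mono {ℓ ℓ' : ℕ} (hle : ℓ ≤ ℓ') {S : Type u} [CommRing S] [IsLocalRing S]
    {n : ℕ} {x : Fin n → S} {I : Ideal S} (h : HasExceptionalDepth ℓ x I) :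
    HasExceptionalDepth ℓ' x I := by
  induction hle with
  | refl => exact h
  | step _ ih => exact ih.succ

/-- `𝔪^N ⊆ I` puts `I` on rung `N` for ANY family `x` inside `𝔪` (take `d = 0`: `I ⊆ 𝔪⁰ = S` and
`x_i^N ∈ 𝔪^N ⊆ I`); no properness of `I` and no `N ≥ 1` needed (cf. F1's `hasExceptionalDepth_of_pow_le`,
which uses `d = 1`). [cite: StacksProject, Tag 00L6] -/
theorem hasExceptionalDepth_of_pow_maximalIdeal_le {S : Type u} [CommRing S] [IsLocalRing S] {n : ℕ}
    (x : Fin n → S) (hx : ∀ i, x i ∈ IsLocalRing.maximalIdeal S) (I : Ideal S) {N : ℕ}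
    (hle : IsLocalRing.maximalIdeal S ^ N ≤ I) : HasExceptionalDepth N x I :=
  ⟨0, by simp, fun i => hle (by simpa only [zero_add] using Ideal.pow_mem_pow (hx i) N)⟩

/-- In a Noetherian local ring, `𝔪 ⊆ √I` (equivalently: every prime over `I` is `𝔪`, or `I = S`) puts `I`
on SOME rung for any family inside `𝔪` (`𝔪` is finitely generated, so `𝔪^N ⊆ I` for some `N`).
[cite: StacksProject, Tag 00L6] -/
theorem hasExceptionalDepth_of_maximalIdeal_le_radical {S : Type u} [CommRing S] [IsLocalRing S]
    [IsNoetherianRing S] {n : ℕ} (x : Fin n → S) (hx : ∀ i, x i ∈ IsLocalRing.maximalIdeal S)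
    (I : Ideal S) (hrad : IsLocalRing.maximalIdeal S ≤ I.radical) : ∃ N : ℕ, HasExceptionalDepth N x I := by
  obtain ⟨N, hN⟩ := Ideal.exists_pow_le_of_le_radical_of_fg hrad (IsNoetherian.noetherian _)
  exact ⟨N, hasExceptionalDepth_of_pow_maximalIdeal_le x hx I hN⟩

/-- A proper-or-unit ideal all of whose prime over-ideals are the maximal ideal satisfies `𝔪 ⊆ √I`
(`√I` is the intersection of the primes over `I`). [cite: StacksProject, Tag 00L6] -/
theorem maximalIdeal_le_radical_of_forall_prime {S : Type u} [CommRing S] [IsLocalRing S] (I : Ideal S)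
    (h : ∀ P : Ideal S, P.IsPrime → I ≤ P → P = IsLocalRing.maximalIdeal S) :
    IsLocalRing.maximalIdeal S ≤ I.radical := by
  rw [Ideal.radical_eq_sInf]
  exact le_sInf fun P hP => (h P hP.2 hP.1).ge

/-! ## §2 The ladder of conclusions: antitone in `ℓ`; BASE RUNG `ℓ ≤ 1` from r-d1 -/

/-- **Rung `ℓ'` covers every lower rung**: `DepthConclusionPerfect` is ANTITONE in `ℓ` (a depth-`ℓ` ideal is
a depth-`ℓ'` ideal for `ℓ ≤ ℓ'`). [folklore] -/
theorem DepthConclusionPerfect.anti {ℓ ℓ' : ℕ} (hle : ℓ ≤ ℓ') (h : DepthConclusionPerfect.{u} ℓ') :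
    DepthConclusionPerfect.{u} ℓ :=
  fun S _ _ hdim hperf n x hx I hI hdepth T f hf => h S hdim hperf n x hx I hI (hdepth.mono hle) T f hf

/-- **The base of the ladder from r-d1's conclusion, fact-free**: `DepthOneConclusion` (no perfectness) gives
`DepthConclusionPerfect ℓ` for every `ℓ ≤ 1`; the perfectness hypothesis is simply not used.
[cite: Kollar2007, (3.111) Step 3] -/
theorem depthConclusionPerfect_of_depthOneConclusion (h : DepthOneTargets.DepthOneConclusion.{u}) {ℓ : ℕ}
    (hℓ : ℓ ≤ 1) : DepthConclusionPerfect.{u} ℓ :=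
  DepthConclusionPerfect.anti hℓ
    fun S _ _ hdim _ n x hx I hI hdepth T f hf => h S hdim n x hx I hI hdepth T f hf

/-- **THE BASE RUNG `ℓ = 1` OF THE DEPTH LADDER, BY NAME**: r-d1 (`DepthOneTargets.depthOne`, lead-2 p498024,
over the six landed targets I1 · D1 · D5 · S-A2 · A2s · A1) IS `DepthConclusionPerfect 1` — for `S` regular
local of Krull dimension `4` with perfect residue field (unused), `x` spanning `𝔪`, `I ≠ 0` of exceptional
depth `1` and any blowing up `T → Spec S` along `I`, a non-zero ideal sheaf on `T` cosupported in the closed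
fibre has regular blowing up — modulo CP 2019 Prop. 4.4 and CJS 2020 Thm. 1.4 / 6.9 (a) (sequence form B),
taken as hypotheses. [cite: CossartPiltant2019, Prop. 4.4] [cite: CossartJannsenSaito2020, Thm. 1.4, Thm. 6.9 (a)]
[cite: Kollar2007, (3.111) Step 3] -/
theorem depthConclusionPerfect_one (hCP : CossartPiltant2019Principalization.{u})
    (hCJS : CossartJannsenSaito2020EmbeddedSequenceB.{u}) : DepthConclusionPerfect.{u} 1 :=
  depthConclusionPerfect_of_depthOneConclusion (DepthOneTargets.depthOne hCP hCJS) le_rfl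

/-- The rungs `ℓ ≤ 1` (i.e. `ℓ ∈ {0, 1}`) of the ladder, modulo the two printed dimension-three facts.
[cite: CossartPiltant2019, Prop. 4.4] [cite: CossartJannsenSaito2020, Thm. 1.4, Thm. 6.9 (a)] -/
theorem depthConclusionPerfect_of_le_one (hCP : CossartPiltant2019Principalization.{u})
    (hCJS : CossartJannsenSaito2020EmbeddedSequenceB.{u}) {ℓ : ℕ} (hℓ : ℓ ≤ 1) :
    DepthConclusionPerfect.{u} ℓ :=
  depthConclusionPerfect_of_depthOneConclusion (DepthOneTargets.depthOne hCP hCJS) hℓ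

/-! ## §3 What the whole ladder buys: the core's conclusion on the ENTIRE `𝔪`-primary stratum -/

/-- **Exhaustion in conclusion form (power version)**: the whole ladder `∀ ℓ, DepthConclusionPerfect ℓ` gives
the core's conclusion for EVERY `I ≠ 0` with `𝔪^N ⊆ I` over a regular local ring of Krull dimension `4` with
perfect residue field and EVERY blowing up along `I` — no spanning family in the statement (`𝔪` is finitely
generated: pick one; `I` sits on rung `N`). [cite: Kollar2007, (3.111) Step 3] [cite: StacksProject, Tag 00L6] -/
theorem core_of_pow_maximalIdeal_le_of_depthLadder (h : ∀ ℓ : ℕ, DepthConclusionPerfect.{u} ℓ)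
    (S : Type u) [CommRing S] [IsRegularLocalRing S] (hdim : ringKrullDim S = (4 : ℕ))
    (hperf : PerfectField (IsLocalRing.ResidueField S)) (I : Ideal S) (hI : I ≠ ⊥) {N : ℕ}
    (hN : IsLocalRing.maximalIdeal S ^ N ≤ I)
    (T : Scheme.{u}) (f : T ⟶ Spec (.of S)) (hf : IsBlowup f (affineBlowup.idealSheaf I)) :
    ∃ (J : T.IdealSheafData) (T' : Scheme.{u}) (π : T' ⟶ T), J ≠ ⊥ ∧
      (∀ t : T, t ∈ J.support → f.base t = IsLocalRing.closedPoint S) ∧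
      IsBlowup π J ∧ Scheme.IsRegular T' := by
  obtain ⟨n, x, hx⟩ := Submodule.fg_iff_exists_fin_generating_family.mp
    (IsNoetherian.noetherian (IsLocalRing.maximalIdeal S))
  have hx' : Ideal.span (Set.range x) = IsLocalRing.maximalIdeal S := hx
  have hxm : ∀ i, x i ∈ IsLocalRing.maximalIdeal S := fun i => by
    rw [← hx']
    exact Ideal.subset_span (Set.mem_range_self i)
  exact h N S hdim hperf n x hx' I hI (hasExceptionalDepth_of_pow_maximalIdeal_le x hxm I hN) T f hf

/-- **Exhaustion in conclusion form (radical version)**: the same for every `I ≠ 0` with `𝔪 ⊆ √I`, i.e. whose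
only prime over-ideal is `𝔪` (or `I = S`) — the ENTIRE `𝔪`-primary-or-unit stratum.
[cite: Kollar2007, (3.111) Step 3] [cite: StacksProject, Tag 00L6] -/
theorem core_of_maximalIdeal_le_radical_of_depthLadder (h : ∀ ℓ : ℕ, DepthConclusionPerfect.{u} ℓ)
    (S : Type u) [CommRing S] [IsRegularLocalRing S] (hdim : ringKrullDim S = (4 : ℕ))
    (hperf : PerfectField (IsLocalRing.ResidueField S)) (I : Ideal S) (hI : I ≠ ⊥)
    (hrad : IsLocalRing.maximalIdeal S ≤ I.radical)
    (T : Scheme.{u}) (f : T ⟶ Spec (.of S)) (hf : IsBlowup f (affineBlowup.idealSheaf I)) :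
    ∃ (J : T.IdealSheafData) (T' : Scheme.{u}) (π : T' ⟶ T), J ≠ ⊥ ∧
      (∀ t : T, t ∈ J.support → f.base t = IsLocalRing.closedPoint S) ∧
      IsBlowup π J ∧ Scheme.IsRegular T' := by
  obtain ⟨N, hN⟩ := Ideal.exists_pow_le_of_le_radical_of_fg hrad (IsNoetherian.noetherian _)
  exact core_of_pow_maximalIdeal_le_of_depthLadder h S hdim hperf I hI hN T f hf

end DepthTargets

/-! ## §4 The composition of record with the WHOLE `𝔪`-primary stratum split off (ladder form) -/

/-- **The crux `FrobeniusClosing.PatchingRelPerfect` BY NAME from the printed dimension-`≤ 3` inputs, the DEPTH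
LADDER, the open core RESTRICTED TO IDEALS WITH POSITIVE-DIMENSIONAL COSUPPORT, and the dimension-`≥ 5`
residual.** The residual stratum of the core: complete regular local `S` of dimension four, characteristic `p`,
perfect residue field, `I ≠ 0` contained in some prime `P ≠ 𝔪` (the cosupport `V(I)` is not the closed point
alone) whose blowing up is regular off `V(𝔪)`. Every `𝔪`-primary-or-unit `I` is served by the ladder
(`DepthTargets.core_of_maximalIdeal_le_radical_of_depthLadder`); lead-1's
`patchingRelPerfect_of_printed_of_depthOne_of_deeper_of_dimGeFive` is the `ℓ = 1` instance of this split.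
CONDITIONAL (the ladder above `ℓ = 1`, the residual stratum and dimension `≥ 5` are open or parked); the item
stays open; nothing is restated weaker. [cite: CossartPiltant2019, Thm. 1.1 and Prop. 4.4]
[cite: CossartJannsenSaito2020, Thm. 1.2] [cite: StacksProject, Tag 080A] -/
theorem patchingRelPerfect_of_printed_of_depthLadder_of_posDimCosupport_of_dimGeFive
    (hG : CossartPiltant2019General.{0}) (hP : CossartPiltant2019Principalization.{0})
    (hCJS : ∀ (X : Scheme.{0}) [IsNoetherian X] [IsReduced X], Scheme.IsExcellent X →
      topologicalKrullDim X ≤ 2 → Scheme.AdmitsDesingularization X)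
    (hladder : ∀ ℓ : ℕ, DepthTargets.DepthConclusionPerfect.{0} ℓ)
    (hpos : ∀ (p : ℕ), p.Prime → ∀ (S : Type) [CommRing S] [IsRegularLocalRing S] [CharP S p]
      [IsAdicComplete (IsLocalRing.maximalIdeal S) S]
      [PerfectField (IsLocalRing.ResidueField S)], ringKrullDim S = (4 : ℕ) →
      ∀ (I : Ideal S), I ≠ ⊥ →
        (∃ P : Ideal S, P.IsPrime ∧ I ≤ P ∧ P ≠ IsLocalRing.maximalIdeal S) →
        ∀ (T : Scheme.{0}) (f : T ⟶ Spec (.of S)),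
        IsBlowup f (affineBlowup.idealSheaf I) →
        (∀ t : T, f.base t ≠ IsLocalRing.closedPoint S → IsRegularLocalRing (T.presheaf.stalk t)) →
        ∃ (J : T.IdealSheafData) (T' : Scheme.{0}) (π : T' ⟶ T), J ≠ ⊥ ∧
          (∀ t : T, t ∈ J.support → f.base t = IsLocalRing.closedPoint S) ∧
          IsBlowup π J ∧ Scheme.IsRegular T')
    (h5 : ∀ (p : ℕ), p.Prime →
      (∀ (k K : Type) [Field k] [CharP k p] [PerfectField k] [Field K] [Algebra k K],
        (⊤ : IntermediateField k K).FG → ∀ O : ValuationSubring K, (∀ c : k, algebraMap k K c ∈ O) →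
          ∀ R : Subalgebra k K, R.FG → R.toSubring ≤ O.toSubring →
            ∃ (A : Subalgebra k K) (h : A.toSubring ≤ O.toSubring), R ≤ A ∧ A.FG ∧
              IsFractionRing A K ∧ IsRegularLocalRing (Localization.AtPrime
                (Ideal.comap (Subring.inclusion h) (IsLocalRing.maximalIdeal O)))) →
      ∀ (k : Type) [Field k] [CharP k p] [PerfectField k] (X : Scheme.{0}) (f : X ⟶ Spec (.of k)),
        IsSeparated f → LocallyOfFiniteType f → QuasiCompact f → IsIntegral X →
        ¬ topologicalKrullDim X ≤ 4 → Scheme.HasResolution X) :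
    Summit.ResolutionOfSingularities.ResolutionOfSingularities.Theses.FrobeniusClosing.PatchingRelPerfect :=
  patchingRelPerfect_of_printed_of_atomDimFourBlowup_of_dimGeFive hG hP hCJS
    (fun p hp S _ _ _ _ _ hdim I hI T f hf hoff => by
      by_cases h : ∃ P : Ideal S, P.IsPrime ∧ I ≤ P ∧ P ≠ IsLocalRing.maximalIdeal S
      · exact hpos p hp S hdim I hI h T f hf hoff
      · have hrad : IsLocalRing.maximalIdeal S ≤ I.radical :=
          DepthTargets.maximalIdeal_le_radical_of_forall_prime I fun P hP hIP =>
            Classical.byContradiction fun hne => h ⟨P, hP, hIP, hne⟩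
        exact DepthTargets.core_of_maximalIdeal_le_radical_of_depthLadder hladder S hdim inferInstance
          I hI hrad T f hf)
    h5

end Summit.ResolutionOfSingularities.ResolutionOfSingularities.Theorems

end
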